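import Mathlib
import HarnessLib
import Summits.Parity.GeneralizedHardyLittlewood.Theses.PrimeDeterminantCells
import Summits.Parity.GeneralizedHardyLittlewood.Theorems.LeeYangFibresFibrationLemmaFinal

/-!
# `CentralCellsDimOne` is the sub-problem modulo the seesaw law (route `PrimeDeterminantCells`)

Support file for the crux `Summit.Parity.GeneralizedHardyLittlewood.Theses.PrimeDeterminantCells.CentralCellsDimOne`
(stmt-Parity-9537, rank 2 of route `PrimeDeterminantCells`; redirect strategist `cstrat-stmt-Parity-9537-r1`,
2026-08-17). It records, against the route file as it stands (rev 17: deciding theorem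
`closes (hC : CentralCellsDimOne) (hL : AlternatingSeesawLawR) (hF : FibrationLift) : GeneralizedHardyLittlewood`),
the POSITION of the crux that both strategist censuses (`Cruxes/CentralCellsDimOne/STRATEGY-CENSUS.md`,
`STRATEGY-CENSUS-r1.md`) rest on:

* `ghl_of_centralCellsDimOne_of_law` — the route's own arrow `C → Law → S`, with the support binder
  `FibrationLift` DISCHARGED by the tree's proved fibration lemma
  `Theorems.FibrationGlue.generalizedHardyLittlewood_of_dimOne` (so no open support remains between the two
  ranked cruxes and the Statement);
* `centralCellsDimOne_of_law_of_ghl` — **the converse seam** `Law → S → C`: given the law, the sub-problem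
  Statement (specialised to `d = 1`) feeds the law's antecedent at every `t' < t` and supplies `|S − M| ≤ εN` at
  `t` itself, so the law's two-term value `(1/3)^t logᵗN · (M + (−1)^t (S − M))` collapses to the cells' value
  `(1/3)^t logᵗN · M`;
* hence `centralCellsDimOne_iff_ghl_of_law : Law → (C ↔ S)` and
  `law_and_centralCellsDimOne_iff : (Law ∧ C) ↔ (Law ∧ S)`.

Reading (tribunal T1(b) / strategist verdict): modulo the route's OTHER crux (rank 3, itself open and of
Elliott–Halberstam + tuple-GEH strength) the rank-2 crux is EQUIVALENT to the sub-problem Statement; the route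
offers no reduction slack between `C` and `S` other than the law. Unconditionally neither `C → S` nor `S → C`
is in the tree (the affine-linear Statement does not see the bilinear weight `W = (Λ·1_{[m^{1/3},m^{2/3}]}) ⋆ Λ`,
and the cells do not see prime tuples without the law's Bombieri-type flips). No statement item is closed by
this file (the theorem types are implications between items, never an item itself). Proof pattern of the
converse seam adapted from the s2 strategist sketch `Cruxes/CentralCellsDimOne/StrategistSketch.lean`
(`cells_of_law_of_dimOne`, written against the rev-10 two-binder `closes`). [folklore]
-/

namespace Summit.Parity.GeneralizedHardyLittlewood.Theorems.PrimeDeterminantCellsCentralCellsModLaw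

open Literature.NumberTheory.Sieve
open Summit.Parity.GeneralizedHardyLittlewood.Theses
open scoped BigOperators Classical

/-- **The sub-problem at `d = 1`** (specialisation of Green–Tao's Conjecture 1.2 to one-dimensional systems,
in the shift-uniform inlined form that is the antecedent of the route's support `FibrationLift` and of the
law's induction hypothesis): `GeneralizedHardyLittlewood` gives, for all `t ≥ 1`, `L`, `ε > 0`, eventually in
`N`, `|vonMangoldtSum Φ K N − archFactor Φ K · singularProduct Φ| ≤ ε N` uniformly over non-degenerate
`Φ : Fin t → AffLinForm 1` with `‖Φ‖_N ≤ L` and convex `K ⊆ [−N, N]`. [cite: GreenTao2010, Conj. 1.2] -/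
theorem dimOne_of_ghl (hS : _root_.GeneralizedHardyLittlewood) :
    ∀ (t L : ℕ), 1 ≤ t → ∀ ε : ℝ, 0 < ε → ∃ N₀ : ℕ, ∀ N : ℕ, N₀ ≤ N →
      ∀ Φ : Fin t → AffLinForm 1, IsNondegenerateSystem Φ → affLinSize Φ N ≤ L →
        ∀ K : Set (Fin 1 → ℝ), Convex ℝ K → K ⊆ realBox 1 N →
          |vonMangoldtSum Φ K N - archFactor Φ K * singularProduct Φ| ≤ ε * (N : ℝ) := by
  intro t L ht ε hε
  obtain ⟨N₀, hN₀⟩ := hS 1 t L le_rfl ht ε hε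
  refine ⟨N₀, fun N hN Φ hΦ hL K hK hKN => ?_⟩
  simpa using hN₀ N hN Φ hΦ hL K hK hKN

/-- **The route's arrow with the support discharged**: `CentralCellsDimOne → AlternatingSeesawLawR →
GeneralizedHardyLittlewood`, i.e. the deciding theorem `PrimeDeterminantCells.closes` with its third binder
`FibrationLift` supplied by the tree's proved fibration lemma
`Theorems.FibrationGlue.generalizedHardyLittlewood_of_dimOne` (Green–Tao 2010, remark after Conj. 1.2).
[cite: GreenTao2010, §1 (remark after Conj. 1.2)] -/
theorem ghl_of_centralCellsDimOne_of_law (hC : PrimeDeterminantCells.CentralCellsDimOne)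
    (hL : PrimeDeterminantCells.AlternatingSeesawLawR) : _root_.GeneralizedHardyLittlewood :=
  PrimeDeterminantCells.closes hC hL (fun h => Theorems.FibrationGlue.generalizedHardyLittlewood_of_dimOne h)

/-- **The converse seam** `AlternatingSeesawLawR → GeneralizedHardyLittlewood → CentralCellsDimOne`.
Given the law at `t` (its antecedent — the `d = 1` statement at every `t' < t` — is supplied by the Statement)
and the Statement at `t` itself (`|S − M| ≤ (ε/2) N`), the cell sum `Σ_{n∈K∩ℤ} Π_i W(ψ_i n)` is within
`(ε/2) N logᵗN` of `(1/3)^t logᵗN (M + (−1)^t (S − M))`, and `(1/3)^t logᵗN · |S − M| ≤ logᵗN · (ε/2) N`;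
the triangle inequality gives the cells' estimate with `ε`. Elementary real arithmetic; no number theory.
[folklore] -/
theorem centralCellsDimOne_of_law_of_ghl (hL : PrimeDeterminantCells.AlternatingSeesawLawR)
    (hS : _root_.GeneralizedHardyLittlewood) : PrimeDeterminantCells.CentralCellsDimOne := by
  have hD := dimOne_of_ghl hS
  intro t L ht ε hε
  obtain ⟨N₁, hN₁⟩ := hL t L ht (fun t' L' ht' _ => hD t' L' ht') (ε / 2) (by positivity)
  obtain ⟨N₂, hN₂⟩ := hD t L ht (ε / 2) (by positivity)
  refine ⟨max N₁ N₂, fun N hN Ψ hΨ hΨL K hK hKN => ?_⟩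
  have h1 := hN₁ N (le_trans (le_max_left _ _) hN) Ψ hΨ hΨL K hK hKN
  have h2 := hN₂ N (le_trans (le_max_right _ _) hN) Ψ hΨ hΨL K hK hKN
  have hlog : 0 ≤ Real.log (N : ℝ) := Real.log_natCast_nonneg N
  have hH0 : 0 ≤ (1 / 3 : ℝ) ^ t * Real.log (N : ℝ) ^ t := by positivity
  have hH1 : (1 / 3 : ℝ) ^ t * Real.log (N : ℝ) ^ t ≤ Real.log (N : ℝ) ^ t := by
    have h13 : (1 / 3 : ℝ) ^ t ≤ 1 := pow_le_one₀ (by norm_num) (by norm_num)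
    have hlt : 0 ≤ Real.log (N : ℝ) ^ t := pow_nonneg hlog t
    calc (1 / 3 : ℝ) ^ t * Real.log (N : ℝ) ^ t ≤ 1 * Real.log (N : ℝ) ^ t :=
          mul_le_mul_of_nonneg_right h13 hlt
      _ = Real.log (N : ℝ) ^ t := one_mul _
  -- abstract real-number core: `Cc` the cell sum, `Hc` the scale `(1/3)^t logᵗN`, `Mm` the Hardy–Littlewood
  -- main term, `Ss` the von Mangoldt sum, `e = ε`
  have key : ∀ (Cc Hc Mm Ss e : ℝ), 0 ≤ Hc → Hc ≤ Real.log (N : ℝ) ^ t → 0 ≤ e →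
      |Cc - Hc * (Mm + (-1 : ℝ) ^ t * (Ss - Mm))| ≤ e / 2 * (N : ℝ) * Real.log (N : ℝ) ^ t →
      |Ss - Mm| ≤ e / 2 * (N : ℝ) → |Cc - Hc * Mm| ≤ e * (N : ℝ) * Real.log (N : ℝ) ^ t := by
    intro Cc Hc Mm Ss e hHc0 hHc1 he hC hSM
    have eq : Cc - Hc * Mm =
        (Cc - Hc * (Mm + (-1 : ℝ) ^ t * (Ss - Mm))) + Hc * ((-1 : ℝ) ^ t * (Ss - Mm)) := by ring
    rw [eq]
    have hsecond : |Hc * ((-1 : ℝ) ^ t * (Ss - Mm))| ≤ Real.log (N : ℝ) ^ t * (e / 2 * (N : ℝ)) := by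
      rw [abs_mul, abs_of_nonneg hHc0, abs_mul, abs_neg_one_pow, one_mul]
      exact mul_le_mul hHc1 hSM (abs_nonneg _) (pow_nonneg hlog t)
    calc |(Cc - Hc * (Mm + (-1 : ℝ) ^ t * (Ss - Mm))) + Hc * ((-1 : ℝ) ^ t * (Ss - Mm))|
        ≤ |Cc - Hc * (Mm + (-1 : ℝ) ^ t * (Ss - Mm))| + |Hc * ((-1 : ℝ) ^ t * (Ss - Mm))| :=
          abs_add_le _ _
      _ ≤ e / 2 * (N : ℝ) * Real.log (N : ℝ) ^ t + Real.log (N : ℝ) ^ t * (e / 2 * (N : ℝ)) :=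
          add_le_add hC hsecond
      _ = e * (N : ℝ) * Real.log (N : ℝ) ^ t := by ring
  exact key _ _ _ _ _ hH0 hH1 hε.le h1 h2

/-- **Modulo the law, the crux IS the sub-problem**: `AlternatingSeesawLawR → (CentralCellsDimOne ↔
GeneralizedHardyLittlewood)`. The `→` direction is the route's deciding theorem with the fibration support
discharged (`ghl_of_centralCellsDimOne_of_law`); the `←` direction is the converse seam
(`centralCellsDimOne_of_law_of_ghl`). This is the kernel-visible form of the strategists' verdict
`no-strategy-short-of-summit` for stmt-Parity-9537: any proof of the rank-2 crux is, given the rank-3 crux, a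
proof of the Statement and conversely — there is no reduction slack between them other than the law itself.
[folklore] -/
theorem centralCellsDimOne_iff_ghl_of_law (hL : PrimeDeterminantCells.AlternatingSeesawLawR) :
    PrimeDeterminantCells.CentralCellsDimOne ↔ _root_.GeneralizedHardyLittlewood :=
  ⟨fun hC => ghl_of_centralCellsDimOne_of_law hC hL, centralCellsDimOne_of_law_of_ghl hL⟩

/-- **Joint form**: the conjunction of the route's two ranked cruxes is equivalent to the conjunction of the
law with the sub-problem Statement, `(AlternatingSeesawLawR ∧ CentralCellsDimOne) ↔
(AlternatingSeesawLawR ∧ GeneralizedHardyLittlewood)` — the pair {law, cells} is a CONJUNCT SPLIT of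
`law ∧ S` (stronger than `S`), not of `S`. [folklore] -/
theorem law_and_centralCellsDimOne_iff :
    (PrimeDeterminantCells.AlternatingSeesawLawR ∧ PrimeDeterminantCells.CentralCellsDimOne) ↔
      (PrimeDeterminantCells.AlternatingSeesawLawR ∧ _root_.GeneralizedHardyLittlewood) :=
  ⟨fun h => ⟨h.1, (centralCellsDimOne_iff_ghl_of_law h.1).mp h.2⟩,
    fun h => ⟨h.1, (centralCellsDimOne_iff_ghl_of_law h.1).mpr h.2⟩⟩

/-- **The route's `Assembly` statement with the induction made explicit is just `closes`**: the implication
`CentralCellsDimOne → AlternatingSeesawLawR → GeneralizedHardyLittlewood` restricted to the `d = 1`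
conclusion, recorded in the inlined shift-uniform form (useful to readers comparing with the sibling route
`DicksonFibration`'s `DimOne`, stmt-Parity-0819, which has this body verbatim). [cite: GreenTao2010, Conj. 1.2] -/
theorem dimOne_of_centralCellsDimOne_of_law (hC : PrimeDeterminantCells.CentralCellsDimOne)
    (hL : PrimeDeterminantCells.AlternatingSeesawLawR) :
    ∀ (t L : ℕ), 1 ≤ t → ∀ ε : ℝ, 0 < ε → ∃ N₀ : ℕ, ∀ N : ℕ, N₀ ≤ N →
      ∀ Φ : Fin t → AffLinForm 1, IsNondegenerateSystem Φ → affLinSize Φ N ≤ L →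
        ∀ K : Set (Fin 1 → ℝ), Convex ℝ K → K ⊆ realBox 1 N →
          |vonMangoldtSum Φ K N - archFactor Φ K * singularProduct Φ| ≤ ε * (N : ℝ) :=
  dimOne_of_ghl (ghl_of_centralCellsDimOne_of_law hC hL)

end Summit.Parity.GeneralizedHardyLittlewood.Theorems.PrimeDeterminantCellsCentralCellsModLaw
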